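import Summits.BirchSwinnertonDyer.BirchSwinnertonDyer.Theorems.GenusKolyvaginAtTwoPowDvdShaCardAtTwoRTEigenAuxiliaryClassDeep
import Summits.BirchSwinnertonDyer.BirchSwinnertonDyer.Theorems.GenusKolyvaginAtTwoPowDvdShaCardAtTwoRTAuxiliaryClassDeepIsotropic
import HarnessLib

/-!
# Route `GenusKolyvaginAtTwo`, crux L_T `PowDvdShaCardAtTwoRT` (stmt-BirchSwinnertonDyer-23242), LINE 18 stub KS, the DROPS —
# THE DEEP `ε`-EIGEN AUXILIARY CLASS AT A DEEP INERT KOLYVAGIN PLACE OF THE HEEGNER FIELD (the local eigenvector discharged)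

Seat `bsd-line-gk2-p5` g24 (cell `bsd-f1-sign2`, SUPPLY lineage), `--supports stmt-BirchSwinnertonDyer-23242` (helper; closes nothing).
THEOREMS ONLY (no definition, no named fact, no `sorry`).  BSD is NOT proved by any of this; neither is the crux nor any stub.

Sequel of `…RTEigenAuxiliaryClassDeep` (this seat): its `exists_eigen_mem_kummerOutside_addOrderOf_dvd` takes a displayed `ε`-eigen
local class `y ∈ H¹(K_w, E[2^M])`.  On the route's frame — `K` imaginary quadratic, `τ` its complex conjugation (`τ ≠ 1`, `τ² = 1`),
`E/ℚ` globally minimal with `Δ < 0`, `ℓ` a Zhang–Kolyvagin prime at `2` with `1 ≤ M ≤ M(ℓ)` and Gross's `FrobEqFrobInfty W K (2^M) ℓ`,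
`w ∋ ℓ` (so `τ • w = w`) — such a `y` EXISTS for either sign, of the maximal order `2^M`: `y = unr(Q₀ + ε τ̃_*Q₀)` on gk2-p3 g23's
regular frame (`…RTRegularFrameAtTwo`: `E[2^M](K̄) = ℤQ₀ ⊕ ℤτ̃_*Q₀` free; `…RTUnramifiedParametrization`: `unr` injective onto the
Kummer condition, `unr ∘ τ̃_* = σ_* ∘ unr`).
* §4 `exists_eigen_unramified_addOrderOf_eq_two_pow` — the `ε`-eigen unramified local class of order `2^M`.
* §5 **`exists_eigen_mem_kummerOutside_addOrderOf_eq_two_pow`** — the deep `ε`-eigen auxiliary class on the frame: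
  `x ∈ H¹_{𝓛, ⊤ on S∪{w}}(K, E[2^M])`, `loc_v x ∈ H_v` (`v ∈ S`; `H_v` Lagrangian and `σ_*`-stable), `τ_* x = ε x`,
  `ord(loc_w x) = 2^a` with **`M ≤ 2a + 2`**, and `2^a ∣ ord x` — for the UP-swap at record depth `r` take `M = L ≥ 2M_r + 6`.
* §6 `exists_eigen_mem_kummerOutside_addOrderOf_eq_two_pow_of_isotropic` — the same with the `H_v` given as «isotropic + half size»
  (the shape the I7 suppliers produce; gk2-p4's `annLeft_eq_of_isotropic_of_sq`).
HONEST FRAMING: closes nothing; `S`, the `H_v` and the Poitou–Tate family are the integrator's (canonical family: `canonical_isPerfect`,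
`isConjCompatible_canonical`; Weil datum: `JET.GlobalDuality.exists_weilPairing_liftEquivariant`).

References: [McCallumLMS1991] §2 Prop. 2.1, §5 proof of Prop. 5.2 (p. 308); [GrossLMS1991] §3 (3.2), §4, §5 (5.1);
[Jetchev2008] §5 Thm. 5.1; [MilneADT2006] I Thm. 4.10.
-/

set_option autoImplicit false
-- the Theorems namespace of this sub repeats the summit name by design (D-0017 nested layout)
set_option linter.dupNamespace false

noncomputable section

open scoped Classical

open CategoryTheory Field NumberField IsDedekindDomain Function WeierstrassCurve
open Literature.NumberTheory.EllipticCurves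
open Literature.NumberTheory.GaloisRepresentations
open Literature.NumberTheory.GaloisCohomology
open Literature.NumberTheory.Automorphic
open Summit.BirchSwinnertonDyer.Rank1Residual.X11b.KummerPT
open Summit.BirchSwinnertonDyer.Rank1Residual.X11b.FiniteDuality
open Summit.BirchSwinnertonDyer.Rank1Residual.X11b.Relaxation
open Summit.BirchSwinnertonDyer.BirchSwinnertonDyer.Theorems.GenusExact.PlusDescent
open Summit.BirchSwinnertonDyer.Rank1Residual.JET.GlobalDuality
open scoped ContRepresentation

namespace Summit.BirchSwinnertonDyer.BirchSwinnertonDyer.Theorems.GenusExact.AuxiliaryClass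

variable (W : WeierstrassCurve ℚ) (K : Type) [Field K] [NumberField K] [W.IsElliptic] [W.IsGloballyMinimal]

/-! ## §4 An `ε`-eigen unramified local class of order `2^M` at a deep inert Kolyvagin place -/

/-- **An `ε`-eigen unramified local class of order `2^M`, either sign.**  On the frame (`K` imaginary quadratic, `τ ≠ 1` fixing `w`,
`Δ < 0`, `ℓ` Zhang–Kolyvagin at `2` with `1 ≤ M ≤ M(ℓ)`, `FrobEqFrobInfty W K (2^M) ℓ`, `w ∋ ℓ`), for `ε = ±1` there is
`y ∈ 𝓛_w ⊂ H¹(K_w, E[2^M])` (the Kummer = unramified condition) with `σ_* y = ε y` and `addOrderOf y = 2^M`: `y = unr(Q₀ + ε τ̃_*Q₀)` for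
the regular generator `Q₀` of `E[2^M](K̄)` over `ℤ/2^M[τ̃_*]`. [cite: GrossLMS1991, §3 (3.2) and §4] [cite: Jetchev2008, §5 Thm. 5.1] -/
theorem exists_eigen_unramified_addOrderOf_eq_two_pow (hK : IsImaginaryQuadratic K) (hΔ : W.Δ < 0)
    {M ℓ : ℕ} (hM : 1 ≤ M)
    (hℓ : Zhang2014.IsKolyvaginPrime (W.conductorNorm ℤ) W K 2 ℓ) (hk : M ≤ Zhang2014.kolyvaginIndex W 2 ℓ)
    (hF : FrobEqFrobInfty W K (2 ^ M) ℓ) (w : HeightOneSpectrum (𝓞 K)) (hw : (ℓ : 𝓞 K) ∈ w.asIdeal)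
    {τ : K ≃ₐ[ℚ] K} (hτ1 : τ ≠ 1) (hfix : τ • w = w) {ε : ℤ} (hε : ε = 1 ∨ ε = -1) :
    ∃ y ∈ (W.baseChange K).kummerSelmerStructure ((2 ^ M : ℕ) : ℤ) (Sum.inr w),
      conjActPlace W τ ((2 ^ M : ℕ) : ℤ) hfix y = ε • y ∧ addOrderOf y = 2 ^ M := by
  haveI : Fact (Nat.Prime 2) := ⟨Nat.prime_two⟩
  have hε2 : ε * ε = 1 := by rcases hε with rfl | rfl <;> norm_num
  -- good reduction and `2 ∉ w`
  obtain ⟨hgood, hpw⟩ := hasGoodReductionAt_of_zhangKolyvaginPrime W K hℓ w hw 1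
  have hpw' : ((2 : ℕ) : 𝓞 K) ∉ w.asIdeal := by rwa [pow_one, Int.cast_natCast] at hpw
  -- the unramified parametrisation and the regular frame
  obtain ⟨unr, hunr0, hunrL, -, hunr⟩ :=
    exists_unramified_parametrization_kummer W K hK (p := 2) (k := M) hℓ hk w hw hpw' hgood τ hfix
  obtain ⟨Q₀, htor, -, hfree, ht⟩ := exists_regular_frame_liftAutPlace W K hK hΔ hM hℓ hk hF w hw hτ1 hfix
  refine ⟨unr (Q₀ + ε • (isLiftOfAut_liftAutPlace τ hfix).torsionMap W ((2 ^ M : ℕ) : ℤ) Q₀), hunrL _, ?_, ?_⟩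
  · -- eigen: `σ_* (unr (Q₀ + ε τ̃Q₀)) = unr (τ̃(Q₀ + ε τ̃Q₀)) = unr (τ̃Q₀ + ε Q₀) = ε • unr (Q₀ + ε τ̃Q₀)`
    rw [← hunr, ← map_zsmul unr]
    congr 1
    rw [map_add, map_zsmul, ht, smul_add, smul_smul, hε2, one_zsmul, add_comm]
  · -- order `2^M`
    rw [addOrderOf_injective unr hunr0]
    have htor' : (2 ^ M) • Q₀ = 0 := by
      rw [← natCast_zsmul]; exact_mod_cast htor
    have h1 : (2 ^ M) • (Q₀ + ε • (isLiftOfAut_liftAutPlace τ hfix).torsionMap W ((2 ^ M : ℕ) : ℤ) Q₀) = 0 := by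
      rw [smul_add, smul_comm, ← map_nsmul, htor', map_zero, smul_zero, add_zero]
    have h2 : 2 ^ M ∣ addOrderOf (Q₀ + ε • (isLiftOfAut_liftAutPlace τ hfix).torsionMap W ((2 ^ M : ℕ) : ℤ) Q₀) := by
      have h0 := addOrderOf_nsmul_eq_zero (Q₀ + ε • (isLiftOfAut_liftAutPlace τ hfix).torsionMap W ((2 ^ M : ℕ) : ℤ) Q₀)
      set n := addOrderOf (Q₀ + ε • (isLiftOfAut_liftAutPlace τ hfix).torsionMap W ((2 ^ M : ℕ) : ℤ) Q₀) with hn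
      have h0' : (n : ℤ) • Q₀ + ((n : ℤ) * ε) • (isLiftOfAut_liftAutPlace τ hfix).torsionMap W ((2 ^ M : ℕ) : ℤ) Q₀ = 0 := by
        rw [← smul_smul, ← smul_add, natCast_zsmul]; exact h0
      have h3 := (hfree (n : ℤ) ((n : ℤ) * ε) h0').1
      exact_mod_cast h3
    exact Nat.dvd_antisymm (addOrderOf_dvd_of_nsmul_eq_zero h1) h2

/-! ## §5 The deep `ε`-eigen auxiliary class on the frame -/

/-- **THE DEEP `ε`-EIGEN AUXILIARY CLASS ON LINE 18's FRAME.**  `K` imaginary quadratic with complex conjugation `τ` (`τ ≠ 1`,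
`τ² = 1`), `E/ℚ` globally minimal with `Δ < 0`, level `2^M` (`M ≥ 1`), a Weil datum `e` on `E[2^M](K̄)` semilinear for the adapted lift
at `w` (`hte`), a Poitou–Tate family `inv` (`IsPerfect`, `SumLocalTermEqZero`, `SelmerComplement`, `IsConjCompatible τ`) and Tate's
count; `ℓ` a Zhang–Kolyvagin prime at `2` with `M ≤ M(ℓ)` and `FrobEqFrobInfty W K (2^M) ℓ`, `w ∋ ℓ` the free place, `S ∌ w` a finite set of
`τ`-fixed finite places carrying Lagrangian, `σ_*`-stable conditions `H_v`.  Then for `ε = ±1` there is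
`x ∈ H¹_{𝓛, ⊤ on S∪{w}}(K, E[2^M])` with `loc_v x ∈ H_v` (`v ∈ S`), **`τ_* x = ε x`**, `ord(loc_w x) = 2^a`, **`M ≤ 2a + 2`**, and
`2^a ∣ ord x`.  (UP-swap at record depth `r`: `M = L ≥ 2M_r + 6` gives `ord x ≥ 2^{M_r+2}`.)
[cite: McCallumLMS1991, §2 Prop. 2.1 and §5 proof of Prop. 5.2 (p. 308)] [cite: MilneADT2006, Ch. I Thm. 4.10] -/
theorem exists_eigen_mem_kummerOutside_addOrderOf_eq_two_pow (hK : IsImaginaryQuadratic K) (hΔ : W.Δ < 0)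
    {M ℓ : ℕ} (hM : 1 ≤ M)
    (hℓ : Zhang2014.IsKolyvaginPrime (W.conductorNorm ℤ) W K 2 ℓ) (hk : M ≤ Zhang2014.kolyvaginIndex W 2 ℓ)
    (hF : FrobEqFrobInfty W K (2 ^ M) ℓ) (w : HeightOneSpectrum (𝓞 K)) (hw : (ℓ : 𝓞 K) ∈ w.asIdeal)
    {τ : K ≃ₐ[ℚ] K} (hτ1 : τ ≠ 1) (hττ : τ * τ = 1) (hfix : τ • w = w)
    (e : (W.baseChange K).geomTorsion ((2 ^ M : ℕ) : ℤ) → (W.baseChange K).geomTorsion ((2 ^ M : ℕ) : ℤ) → AlgebraicClosure K)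
    (hμ : ∀ S T, e S T ^ (2 ^ M) = 1)
    (hadd₁ : ∀ S₁ S₂ T, e (S₁ + S₂) T = e S₁ T * e S₂ T)
    (hadd₂ : ∀ S T₁ T₂, e S (T₁ + T₂) = e S T₁ * e S T₂)
    (hgal : ∀ (γ : absoluteGaloisGroup K) (S T : (W.baseChange K).geomTorsion ((2 ^ M : ℕ) : ℤ)), γ • e S T = e (γ • S) (γ • T))
    (halt : ∀ T, e T T = 1) (hnondeg : ∀ T, (∀ S, e S T = 1) → T = 0)
    (hte : ∀ S T, e ((isLiftOfAut_liftAutPlace τ hfix).torsionMap W ((2 ^ M : ℕ) : ℤ) S)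
      ((isLiftOfAut_liftAutPlace τ hfix).torsionMap W ((2 ^ M : ℕ) : ℤ) T) = liftAutPlace τ hfix (e S T))
    {inv : LocalInvariants K (2 ^ M)} (hperf : inv.IsPerfect) (hsum : inv.SumLocalTermEqZero)
    (hcompl : inv.SelmerComplement) (hconj : inv.IsConjCompatible τ)
    (hEuler : ∀ v : HeightOneSpectrum (𝓞 K),
      Nat.card (galoisCohomology (((W.baseChange K).torsionGaloisModule ((2 ^ M : ℕ) : ℤ)).toLocal (Sum.inr v)) 1) =
        (Nat.card (nsmulAddMonoidHom (2 ^ M) :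
            ((W.baseChange K).baseChange (v.adicCompletion K)).toAffine.Point →+ _).ker *
          Nat.card (v.adicCompletionIntegers K ⧸
            Ideal.span {((2 ^ M : ℕ) : v.adicCompletionIntegers K)})) ^ 2)
    (S : Finset (HeightOneSpectrum (𝓞 K))) (hwS : w ∉ S) (hfixS : ∀ v ∈ S, τ • v = v)
    (H : ∀ v : HeightOneSpectrum (𝓞 K),
      AddSubgroup (galoisCohomology (((W.baseChange K).torsionGaloisModule ((2 ^ M : ℕ) : ℤ)).toLocal (Sum.inr v)) 1))
    (hH : ∀ v ∈ S, annLeft (invWeilPairing (W.baseChange K) (2 ^ M) e hμ hadd₁ hadd₂ hgal inv (Sum.inr v)) (H v) = H v)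
    (hHc : ∀ v (hv : v ∈ S), ∀ X ∈ H v, conjActPlace W τ ((2 ^ M : ℕ) : ℤ) (hfixS v hv) X ∈ H v)
    {ε : ℤ} (hε : ε = 1 ∨ ε = -1) :
    ∃ x ∈ kummerOutside (W.baseChange K) (2 ^ M) ((insert w S).map Function.Embedding.inr),
      (∀ v ∈ S, galoisCohomology.localization ((W.baseChange K).torsionGaloisModule ((2 ^ M : ℕ) : ℤ)) (Sum.inr v) 1 x ∈ H v) ∧
      conjAct W τ ((2 ^ M : ℕ) : ℤ) x = ε • x ∧
      ∃ a : ℕ, addOrderOf (galoisCohomology.localization ((W.baseChange K).torsionGaloisModule ((2 ^ M : ℕ) : ℤ))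
          (Sum.inr w) 1 x) = 2 ^ a ∧ M ≤ 2 * a + 2 ∧ 2 ^ a ∣ addOrderOf x := by
  haveI : Fact (Nat.Prime 2) := ⟨Nat.prime_two⟩
  obtain ⟨y, -, hyσ, hyM⟩ := exists_eigen_unramified_addOrderOf_eq_two_pow W K hK hΔ hM hℓ hk hF w hw hτ1 hfix hε
  obtain ⟨x, hx, hxH, hxε, hdvd⟩ := exists_eigen_mem_kummerOutside_addOrderOf_dvd W τ 2 M e hμ hadd₁ hadd₂ hgal halt hnondeg
    (fun w' ↦ hK.2.isComplex w') hττ hperf hsum hcompl hconj hEuler S w hwS hfixS hfix H hH hHc hte hε hyσ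
  refine ⟨x, hx, hxH, hxε, ?_⟩
  haveI := finite_galoisCohomology_toLocal_inr (W.baseChange K) (2 ^ M) w
  set xw := galoisCohomology.localization ((W.baseChange K).torsionGaloisModule ((2 ^ M : ℕ) : ℤ)) (Sum.inr w) 1 x with hxw
  have hr' : addOrderOf xw ∣ 2 ^ M :=
    addOrderOf_dvd_of_nsmul_eq_zero (nsmul_galoisCohomology_toLocal_eq_zero (W.baseChange K) (2 ^ M) _ _)
  obtain ⟨a, -, hra⟩ := (Nat.dvd_prime_pow Nat.prime_two).mp hr'
  refine ⟨a, hra, ?_, ?_⟩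
  · rw [hyM, hra, ← pow_mul, show (4 : ℕ) = 2 ^ 2 by norm_num, ← pow_add] at hdvd
    have h := (Nat.pow_dvd_pow_iff_le_right one_lt_two).mp hdvd
    omega
  · rw [← hra]
    exact addOrderOf_map_dvd _ x

/-! ## §6 «Isotropy + count» form of the frame theorem -/

/-- **The deep `ε`-eigen auxiliary class on the frame, «isotropy + count» form**: as
`exists_eigen_mem_kummerOutside_addOrderOf_eq_two_pow`, with the conditions `H_v` (`v ∈ S`) given ISOTROPIC for `inv_v(· ∪ₑ ·)` and of
half size (`#H_v² = #H¹(K_v, E[2^M])`) instead of Lagrangian — the shape delivered for the transverse condition at the own Kolyvagin primes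
(I7 + count). [cite: McCallumLMS1991, §2 Prop. 2.1 and §5 proof of Prop. 5.2 (p. 308)] [cite: MilneADT2006, Ch. I, Prop. 0.19 and Thm. 4.10] -/
theorem exists_eigen_mem_kummerOutside_addOrderOf_eq_two_pow_of_isotropic (hK : IsImaginaryQuadratic K) (hΔ : W.Δ < 0)
    {M ℓ : ℕ} (hM : 1 ≤ M)
    (hℓ : Zhang2014.IsKolyvaginPrime (W.conductorNorm ℤ) W K 2 ℓ) (hk : M ≤ Zhang2014.kolyvaginIndex W 2 ℓ)
    (hF : FrobEqFrobInfty W K (2 ^ M) ℓ) (w : HeightOneSpectrum (𝓞 K)) (hw : (ℓ : 𝓞 K) ∈ w.asIdeal)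
    {τ : K ≃ₐ[ℚ] K} (hτ1 : τ ≠ 1) (hττ : τ * τ = 1) (hfix : τ • w = w)
    (e : (W.baseChange K).geomTorsion ((2 ^ M : ℕ) : ℤ) → (W.baseChange K).geomTorsion ((2 ^ M : ℕ) : ℤ) → AlgebraicClosure K)
    (hμ : ∀ S T, e S T ^ (2 ^ M) = 1)
    (hadd₁ : ∀ S₁ S₂ T, e (S₁ + S₂) T = e S₁ T * e S₂ T)
    (hadd₂ : ∀ S T₁ T₂, e S (T₁ + T₂) = e S T₁ * e S T₂)
    (hgal : ∀ (γ : absoluteGaloisGroup K) (S T : (W.baseChange K).geomTorsion ((2 ^ M : ℕ) : ℤ)), γ • e S T = e (γ • S) (γ • T))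
    (halt : ∀ T, e T T = 1) (hnondeg : ∀ T, (∀ S, e S T = 1) → T = 0)
    (hte : ∀ S T, e ((isLiftOfAut_liftAutPlace τ hfix).torsionMap W ((2 ^ M : ℕ) : ℤ) S)
      ((isLiftOfAut_liftAutPlace τ hfix).torsionMap W ((2 ^ M : ℕ) : ℤ) T) = liftAutPlace τ hfix (e S T))
    {inv : LocalInvariants K (2 ^ M)} (hperf : inv.IsPerfect) (hsum : inv.SumLocalTermEqZero)
    (hcompl : inv.SelmerComplement) (hconj : inv.IsConjCompatible τ)
    (hEuler : ∀ v : HeightOneSpectrum (𝓞 K),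
      Nat.card (galoisCohomology (((W.baseChange K).torsionGaloisModule ((2 ^ M : ℕ) : ℤ)).toLocal (Sum.inr v)) 1) =
        (Nat.card (nsmulAddMonoidHom (2 ^ M) :
            ((W.baseChange K).baseChange (v.adicCompletion K)).toAffine.Point →+ _).ker *
          Nat.card (v.adicCompletionIntegers K ⧸
            Ideal.span {((2 ^ M : ℕ) : v.adicCompletionIntegers K)})) ^ 2)
    (S : Finset (HeightOneSpectrum (𝓞 K))) (hwS : w ∉ S) (hfixS : ∀ v ∈ S, τ • v = v)
    (H : ∀ v : HeightOneSpectrum (𝓞 K),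
      AddSubgroup (galoisCohomology (((W.baseChange K).torsionGaloisModule ((2 ^ M : ℕ) : ℤ)).toLocal (Sum.inr v)) 1))
    (hiso : ∀ v ∈ S, ∀ a ∈ H v, ∀ a' ∈ H v,
      invWeilPairing (W.baseChange K) (2 ^ M) e hμ hadd₁ hadd₂ hgal inv (Sum.inr v) a a' = 0)
    (hHcard : ∀ v ∈ S, Nat.card (H v) ^ 2 =
      Nat.card (galoisCohomology (((W.baseChange K).torsionGaloisModule ((2 ^ M : ℕ) : ℤ)).toLocal (Sum.inr v)) 1))
    (hHc : ∀ v (hv : v ∈ S), ∀ X ∈ H v, conjActPlace W τ ((2 ^ M : ℕ) : ℤ) (hfixS v hv) X ∈ H v)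
    {ε : ℤ} (hε : ε = 1 ∨ ε = -1) :
    ∃ x ∈ kummerOutside (W.baseChange K) (2 ^ M) ((insert w S).map Function.Embedding.inr),
      (∀ v ∈ S, galoisCohomology.localization ((W.baseChange K).torsionGaloisModule ((2 ^ M : ℕ) : ℤ)) (Sum.inr v) 1 x ∈ H v) ∧
      conjAct W τ ((2 ^ M : ℕ) : ℤ) x = ε • x ∧
      ∃ a : ℕ, addOrderOf (galoisCohomology.localization ((W.baseChange K).torsionGaloisModule ((2 ^ M : ℕ) : ℤ))
          (Sum.inr w) 1 x) = 2 ^ a ∧ M ≤ 2 * a + 2 ∧ 2 ^ a ∣ addOrderOf x := by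
  haveI : Fact (Nat.Prime 2) := ⟨Nat.prime_two⟩
  haveI : NeZero (2 ^ M) := ⟨pow_ne_zero M two_ne_zero⟩
  have hH : ∀ v ∈ S, annLeft (invWeilPairing (W.baseChange K) (2 ^ M) e hμ hadd₁ hadd₂ hgal inv (Sum.inr v)) (H v) = H v :=
    fun v hv ↦ by
    haveI := finite_galoisCohomology_toLocal_inr (W.baseChange K) (2 ^ M) v
    exact annLeft_eq_of_isotropic_of_sq (fun x ↦ nsmul_galoisCohomology_toLocal_eq_zero (W.baseChange K) (2 ^ M) _ x) _
      (invWeilPairing_bijective (W.baseChange K) (2 ^ M) e hμ hadd₁ hadd₂ hgal hnondeg inv v (hperf v).1.1) (H v) (hiso v hv)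
      (hHcard v hv)
  exact exists_eigen_mem_kummerOutside_addOrderOf_eq_two_pow W K hK hΔ hM hℓ hk hF w hw hτ1 hττ hfix e hμ hadd₁ hadd₂ hgal halt
    hnondeg hte hperf hsum hcompl hconj hEuler S hwS hfixS H hH hHc hε

end Summit.BirchSwinnertonDyer.BirchSwinnertonDyer.Theorems.GenusExact.AuxiliaryClass

end
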